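import Mathlib
import HarnessLib
import Summits.HubbardSuperconductivity.HubbardSuperconductivity.Theorems.KLProgrammePolarRayCoareaJacobianFrame
import Summits.HubbardSuperconductivity.HubbardSuperconductivity.Theorems.KLProgrammeKLRegimeEnginePairTransferOutClassSameFrame

/-!
# Route `KLProgramme` — ENGINE item stmt-HubbardSuperconductivity-20437 `KLRegimeEngineV17F2`, stub (c) value lane, «(c)-OUT»: THE FRAME-WINDOW HYPOTHESES OF THE SIGNED
# ROWS FROM THE KL REGIME — one lemma discharging `(B, Af, hAb, hA, hA20, hμ, hlo, hhi, hM)` of `outClass_sameFrame_le_slots(_signedBorn)` and of every signed row of this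
# lineage (cell gate-hubbard-kl, seat hubbard-kl-k3c2-p2 g18; OUT-OF-CLASS-E2.md §7 row «frame window»)

The signed forward-window rows (`klms_memberPH_direct/crossed_signed_le`, `klms_memberBorn_signed_le`) and the capstones (…OutClassSameFrame, …OutClassSameFrameBorn)
carry the frame-window binders: a band bundle `B : BandBounds a′ b′`, a `C²` size `Af` of the frame shift `δ_K` (`hAb`), `4Af < B.Dtmin`, `4Af ≤ 1/20`, `μ ≤ −0.15`,
the shell window `a′ < μ − 4Λₙ₊₁ − 4Af`, `μ + 4Λₙ₊₁ + 4Af < b′`, and the Matsubara count `β·4Λₙ₊₁/(2π) + 1 ≤ M`.  In the KL regime they hold with the CANONICAL choices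
`B := bandBounds (a = −6/5, b = −1/10)` (the uniform bundle of `HubbardBandSectorCountingBounds`) and `Af := 2·Gfr₀·|U| + 2·Gfr₁·U² + Gfr₂·c/log 4`
(`klrk_frame_C2_bound`, from `FrameOK R U (nScales β) μ K` and `klBetaMin ≤ β ≤ e^{c/U²}`), under the thresholds (same shape as `fixedTupleL1_klIsoKernelAt_le_regime`)
`c ≤ κ/(12(Gfr₂+1))`, `U ≤ min 1 (κ/(24(Gfr₀+Gfr₁+1)))`, `κ = min (Dtmin/4) (1/40)`, `μ ∈ klWindowC`, `β ≤ M`: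
**`signedRows_frameWindow_of_regime`** returns all seven facts at every scale `n` (`4Λₙ₊₁ ≤ klE0 = 1/32`, `4Af ≤ (2/3)κ ≤ 1/60`).
Pure arithmetic on the regime; nothing about the model is asserted; nothing asserts (E2″-F), (c), K3 or superconductivity.  0 kit · 0 lit.
-/

noncomputable section

namespace Summit.HubbardSuperconductivity.HubbardSuperconductivity.Theorems.KLRegimeSplit

set_option linter.dupNamespace false -- summit = problem name (single-conjunct summit), D-0017

open Real Set Literature.MathematicalPhysics.QuantumLattice
open Literature.MathematicalPhysics.QuantumLattice.BandSectorCounting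
open Summit.HubbardSuperconductivity.HubbardSuperconductivity.Theorems.PerturbedFermiCurve
open Summit.HubbardSuperconductivity.HubbardSuperconductivity.Theorems.DispersionFlow
open Summit.HubbardSuperconductivity.HubbardSuperconductivity.Theorems.KLProgrammeLegKernels

/-- In the KL regime with the thresholds of the module docstring the frame shift is uniformly small in `C²`:
`2Gfr₀|U| + 2Gfr₁U² + Gfr₂·c/log 4 ≤ κ/6`, `κ = min (Dtmin/4) (1/40)`. -/
theorem frameSize_le_of_thresholds {R : RenConsts} (hR : ∀ j, 0 ≤ R.Gfr j) {c U κ : ℝ} (hc : 0 < c)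
    (hcle : c ≤ κ / (12 * (R.Gfr 2 + 1))) (hU : 0 < U) (hUle : U ≤ min 1 (κ / (24 * (R.Gfr 0 + R.Gfr 1 + 1)))) :
    2 * R.Gfr 0 * |U| + 2 * R.Gfr 1 * U ^ 2 + R.Gfr 2 * (c / Real.log 4) ≤ κ / 6 := by
  have h0' := hR 0; have h1' := hR 1; have h2' := hR 2
  have hU1 : U ≤ 1 := hUle.trans (min_le_left _ _)
  have hUk : U ≤ κ / (24 * (R.Gfr 0 + R.Gfr 1 + 1)) := hUle.trans (min_le_right _ _)
  have hlog : 1 ≤ Real.log 4 := by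
    have h4 : Real.exp 1 ≤ 4 := by have := Real.exp_one_lt_d9; norm_num at this; linarith
    calc (1 : ℝ) = Real.log (Real.exp 1) := (Real.log_exp 1).symm
      _ ≤ Real.log 4 := Real.log_le_log (Real.exp_pos 1) h4
  rw [abs_of_pos hU]
  have hU2 : U ^ 2 ≤ U := by nlinarith only [hU, hU1]
  have hA1 : 2 * R.Gfr 0 * U + 2 * R.Gfr 1 * U ^ 2 ≤ 2 * (R.Gfr 0 + R.Gfr 1 + 1) * U := by
    have := mul_le_mul_of_nonneg_left hU2 h1'
    linarith only [this, hU.le]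
  have hB1 : 2 * (R.Gfr 0 + R.Gfr 1 + 1) * U ≤ κ / 12 := by
    have hpos : 0 < 24 * (R.Gfr 0 + R.Gfr 1 + 1) := by positivity
    have := (le_div_iff₀ hpos).mp hUk
    linarith only [this]
  have hC1 : R.Gfr 2 * (c / Real.log 4) ≤ R.Gfr 2 * c := mul_le_mul_of_nonneg_left (div_le_self hc.le hlog) h2'
  have hD1 : R.Gfr 2 * c ≤ κ / 12 := by
    have hpos : 0 < 12 * (R.Gfr 2 + 1) := by positivity
    have := (le_div_iff₀ hpos).mp hcle
    linarith only [this, hc.le]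
  linarith only [hA1, hB1, hC1, hD1]

/-- **THE FRAME-WINDOW HYPOTHESES OF THE SIGNED ROWS, FROM THE KL REGIME** (module docstring): with `B := bandBounds ha hab hb` (`a = −6/5`, `b = −1/10`) and
`Af := 2Gfr₀|U| + 2Gfr₁U² + Gfr₂·c/log 4`, every scale `n`:
`hAb ∧ 4Af < B.Dtmin ∧ 4Af ≤ 1/20 ∧ μ ≤ −0.15 ∧ −6/5 < μ − 4Λₙ₊₁ − 4Af ∧ μ + 4Λₙ₊₁ + 4Af < −1/10 ∧ β·4Λₙ₊₁/(2π) + 1 ≤ M`. -/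
theorem signedRows_frameWindow_of_regime (ha : (-4 : ℝ) < -(6 / 5)) (hab : (-(6 / 5) : ℝ) ≤ -(1 / 10)) (hb : (-(1 / 10) : ℝ) < 0)
    {R : RenConsts} (hR : ∀ j, 0 ≤ R.Gfr j) {c U β μ : ℝ} (hc : 0 < c)
    (hcle : c ≤ min ((bandBounds ha hab hb).Dtmin / 4) (1 / 40) / (12 * (R.Gfr 2 + 1)))
    (hU : 0 < U) (hUle : U ≤ min 1 (min ((bandBounds ha hab hb).Dtmin / 4) (1 / 40) / (24 * (R.Gfr 0 + R.Gfr 1 + 1))))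
    (hβ : klBetaMin ≤ β) (hβc : β ≤ Real.exp (c / U ^ 2)) (hμ : μ ∈ klWindowC) {K : TrigPolyC4v} (hK : FrameOK R U (nScales β) μ K)
    {M : ℕ} (hβM : β ≤ (M : ℝ)) (n : ℕ) :
    (∀ p : Momentum, ∀ j ≤ 2, ‖iteratedFDeriv ℝ j (frameShift K) p‖ ≤ 2 * R.Gfr 0 * |U| + 2 * R.Gfr 1 * U ^ 2 + R.Gfr 2 * (c / Real.log 4)) ∧
      4 * (2 * R.Gfr 0 * |U| + 2 * R.Gfr 1 * U ^ 2 + R.Gfr 2 * (c / Real.log 4)) < (bandBounds ha hab hb).Dtmin ∧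
      4 * (2 * R.Gfr 0 * |U| + 2 * R.Gfr 1 * U ^ 2 + R.Gfr 2 * (c / Real.log 4)) ≤ 1 / 20 ∧
      μ ≤ -0.15 ∧
      (-(6 / 5) : ℝ) < μ - 4 * klScale klE0 (n + 1) - 4 * (2 * R.Gfr 0 * |U| + 2 * R.Gfr 1 * U ^ 2 + R.Gfr 2 * (c / Real.log 4)) ∧
      μ + 4 * klScale klE0 (n + 1) + 4 * (2 * R.Gfr 0 * |U| + 2 * R.Gfr 1 * U ^ 2 + R.Gfr 2 * (c / Real.log 4)) < -(1 / 10) ∧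
      β * (4 * klScale klE0 (n + 1)) / (2 * Real.pi) + 1 ≤ M := by
  set Bb : BandBounds (-(6 / 5)) (-(1 / 10)) := bandBounds ha hab hb with hBdef
  set κ : ℝ := min (Bb.Dtmin / 4) (1 / 40) with hκ
  have hDt : 0 < Bb.Dtmin := Bb.Dtmin_pos
  have hκpos : 0 < κ := by rw [hκ]; exact lt_min (by positivity) (by norm_num)
  have hκ40 : κ ≤ 1 / 40 := min_le_right _ _
  have hκD : κ ≤ Bb.Dtmin / 4 := min_le_left _ _
  set Af : ℝ := 2 * R.Gfr 0 * |U| + 2 * R.Gfr 1 * U ^ 2 + R.Gfr 2 * (c / Real.log 4) with hAf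
  have hAfle : Af ≤ κ / 6 := frameSize_le_of_thresholds hR hc hcle hU hUle
  have hAb : ∀ p : Momentum, ∀ j ≤ 2, ‖iteratedFDeriv ℝ j (frameShift K) p‖ ≤ Af := klrk_frame_C2_bound hR hc.le hβ hβc hK
  -- the scale: `4Λₙ₊₁ ≤ klE0 = 1/32`
  have hΛ0 : 0 < klScale klE0 (n + 1) := klth_klScale_pos (n + 1)
  have hΛ : 4 * klScale klE0 (n + 1) ≤ 1 / 32 := by
    have hsc : klScale klE0 (n + 1) = klE0 * ((4 : ℝ) ^ (n + 1))⁻¹ := rfl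
    have he0 : klE0 = 1 / 32 := rfl
    have h4 : (4 : ℝ) ≤ (4 : ℝ) ^ (n + 1) := by
      calc (4 : ℝ) = 4 ^ 1 := by norm_num
        _ ≤ 4 ^ (n + 1) := pow_le_pow_right₀ (by norm_num) (by omega)
    have hinv : ((4 : ℝ) ^ (n + 1))⁻¹ ≤ 1 / 4 := by rw [one_div]; exact inv_anti₀ (by norm_num) h4
    rw [hsc, he0]
    nlinarith only [hinv]
  obtain ⟨hμlo, hμhi⟩ := hμ
  have hβ0 : 0 < β := pos_of_klBetaMin_le hβ
  have hβ128 : (128 : ℝ) ≤ β := by rw [klBetaMin] at hβ; exact hβ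
  have hπ3 := Real.pi_gt_three
  refine ⟨hAb, ?_, ?_, by norm_num at hμhi ⊢; linarith only [hμhi], ?_, ?_, ?_⟩
  · linarith only [hAfle, hκD, hDt]
  · linarith only [hAfle, hκ40]
  · norm_num at hμlo ⊢
    linarith only [hμlo, hΛ, hAfle, hκ40]
  · norm_num at hμhi ⊢
    linarith only [hμhi, hΛ, hAfle, hκ40]
  · -- `β·4Λ/(2π) + 1 ≤ β/(64π) + 1 ≤ β ≤ M`
    have h1 : β * (4 * klScale klE0 (n + 1)) / (2 * Real.pi) ≤ β * (1 / 32) / (2 * Real.pi) :=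
      div_le_div_of_nonneg_right (mul_le_mul_of_nonneg_left hΛ hβ0.le) (by positivity)
    have h2 : β * (1 / 32) / (2 * Real.pi) ≤ β / 192 := by
      rw [div_le_div_iff₀ (by positivity) (by norm_num)]
      nlinarith only [hπ3, hβ0]
    linarith only [h1, h2, hβ128, hβM]

end Summit.HubbardSuperconductivity.HubbardSuperconductivity.Theorems.KLRegimeSplit

end
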